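import Summits.KontsevichZagierPeriods.KontsevichZagierPeriods.Theorems.FermatIsogenyBetaLinearSectorHalfIntegers
import Summits.KontsevichZagierPeriods.KontsevichZagierPeriods.Theorems.FermatIsogenyBetaLinearSectorTranslationClass
import Literature.NumberTheory.Transcendental.KZCalculus
import HarnessLib

/-!
# `BetaLinearSector` (stmt-KontsevichZagierPeriods-3897), line `fermat-sector-transport` — stub
# `stub_fermatS3Class` (S3: the obvious Koblitz–Rohrlich class of a holomorphic triple, all levels)

Crux `BetaLinearSector`: for positive rationals `a b a' b'` and a real algebraic `c`, two one-dimensional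
Kontsevich–Zagier representations pinned on `(0,1)` as `[t^{a-1}(1-t)^{b-1}]` and `[c·t^{a'-1}(1-t)^{b'-1}]`
with the same value are KZ-equivalent.

THIS file is the COMBINATORIAL assembly of reshape 3 (section `Sector`).  Write
`P⟦a, b, a', b'⟧` for the two-sided, constant-carrying statement "any two representations pinned as
`[c·β(a,b)]`, `[c'·β(a',b')]` (`c, c'` real algebraic) with equal values are equivalent" of
`Theorems/FermatIsogenyBetaLinearSectorHalfIntegers.lean`.  ASSUMING the two-sided reflection
`P⟦a, b, 1 − a − b, b⟧` for every holomorphic triple (`a, b > 0`, `a + b < 1`; the neighbouring stub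
`stub_pinnedReflect`, the `S₃`-symmetry of the Fermat curve exchanging two cusps), the crux holds for every
pair `(a, b)`, `(a', b')` congruent modulo `ℤ²` to two members of the `S₃`-orbit
`{(a₀,b₀), (b₀,a₀), (t₀,b₀), (b₀,t₀), (a₀,t₀), (t₀,a₀)}`, `t₀ = 1 − a₀ − b₀`, of a holomorphic triple:

* reduce the left pair, then (via `P_symm`) the right pair, to the base window `(0,1]` inside their classes
  modulo `ℤ` (`P_of_class_left`, chains of translations and swaps inside the rules);
* a class modulo `ℤ` meets the window in one point (`eq_of_window`), and `a₀, b₀, t₀ ∈ (0,1)`, so the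
  reduced pairs ARE `(a₀, b₀)` and the given orbit member `(a₁, b₁)`;
* the six members: the diagonal `P_diag`, its swap `P_swap_left`, the reflection of `(a₀, b₀, t₀)` and of
  `(b₀, a₀, t₀)` (note `1 − b₀ − a₀ = t₀`), and their swaps on either side.

Pure bookkeeping over `ℚ`; no analysis and no transcendence input beyond the hypothesis.

References: M. Kontsevich, D. Zagier, *Periods* (2001), §1.2; N. Koblitz, D. Rohrlich, *Simple factors in
the Jacobian of a Fermat curve* (1978), p. 1184 (the "obvious" relations among Beta values).
-/

noncomputable section

namespace Summit.KontsevichZagierPeriods.FermatIsogeny.BetaLinearSector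

open MeasureTheory Set
open Literature.NumberTheory.Transcendental
open Literature.NumberTheory.Transcendental.KZ
open Summit.KontsevichZagierPeriods.FermatIsogeny.BetaLinearSector.HalfIntegers
open Summit.KontsevichZagierPeriods.FermatIsogeny.BetaLinearSector.TranslationClass

/-- The coordinates of the `S₃`-orbit of a holomorphic triple lie in the base window: if `a₀, b₀ > 0`,
`a₀ + b₀ < 1` and `(a₁, b₁)` is one of `(a₀,b₀), (b₀,a₀), (t₀,b₀), (b₀,t₀), (a₀,t₀), (t₀,a₀)`,
`t₀ = 1 − a₀ − b₀`, then `0 < a₁ ≤ 1` and `0 < b₁ ≤ 1`. [folklore] -/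
theorem orbit_mem_window {a₀ b₀ a₁ b₁ : ℚ} (ha₀ : 0 < a₀) (hb₀ : 0 < b₀) (hab : a₀ + b₀ < 1)
    (h : (a₁ = a₀ ∧ b₁ = b₀) ∨ (a₁ = b₀ ∧ b₁ = a₀) ∨ (a₁ = 1 - a₀ - b₀ ∧ b₁ = b₀) ∨
      (a₁ = b₀ ∧ b₁ = 1 - a₀ - b₀) ∨ (a₁ = a₀ ∧ b₁ = 1 - a₀ - b₀) ∨ (a₁ = 1 - a₀ - b₀ ∧ b₁ = a₀)) :
    0 < a₁ ∧ a₁ ≤ 1 ∧ 0 < b₁ ∧ b₁ ≤ 1 := by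
  rcases h with ⟨h1, h2⟩ | ⟨h1, h2⟩ | ⟨h1, h2⟩ | ⟨h1, h2⟩ | ⟨h1, h2⟩ | ⟨h1, h2⟩ <;>
    exact ⟨by linarith, by linarith, by linarith, by linarith⟩

/-- SECTOR STUB S3 (the obvious class, implication-shaped): if the two-sided reflection holds for every
holomorphic triple, then the crux holds for every pair `(a, b)`, `(a′, b′)` congruent modulo `ℤ²` to two
members of the `S₃`-orbit `{(a₀,b₀), (b₀,a₀), (t₀,b₀), (b₀,t₀), (a₀,t₀), (t₀,a₀)}`, `t₀ = 1 − a₀ − b₀`, of a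
holomorphic triple (`a₀, b₀ > 0`, `a₀ + b₀ < 1`): level reduction on both pairs (`P_of_class_left`,
`P_symm`), uniqueness of the window representative (`eq_of_window`), and the six cases by `P_diag`,
`P_swap_left` and the reflection. [cite: KontsevichZagier2001, §1.2] -/
theorem stub_fermatS3Class :
    (∀ (a b : ℚ), 0 < a → 0 < b → a + b < 1 → ∀ (c c' : ℝ) (r r' : KZ.IntegralRep 1),
      IsAlgebraic ℚ c → IsAlgebraic ℚ c' →
      (r.domain = {x | x 0 ∈ Set.Ioo (0:ℝ) 1} ∧
        Set.EqOn r.integrand (fun x => c * (x 0) ^ ((a:ℝ) - 1) * (1 - x 0) ^ ((b:ℝ) - 1)) r.domain) →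
      (r'.domain = {x | x 0 ∈ Set.Ioo (0:ℝ) 1} ∧
        Set.EqOn r'.integrand (fun x => c' * (x 0) ^ (((1 - a - b : ℚ) : ℝ) - 1) * (1 - x 0) ^ ((b:ℝ) - 1)) r'.domain) →
      r.value = r'.value → KZ.Equivalent r r') →
    ∀ (a b a' b' : ℚ) (c : ℝ), 0 < a → 0 < b → 0 < a' → 0 < b' → IsAlgebraic ℚ c →
    (∃ (a₀ b₀ a₁ b₁ : ℚ) (i j i' j' : ℤ), 0 < a₀ ∧ 0 < b₀ ∧ a₀ + b₀ < 1 ∧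
      a = a₀ + i ∧ b = b₀ + j ∧ a' = a₁ + i' ∧ b' = b₁ + j' ∧
      ((a₁ = a₀ ∧ b₁ = b₀) ∨ (a₁ = b₀ ∧ b₁ = a₀) ∨ (a₁ = 1 - a₀ - b₀ ∧ b₁ = b₀) ∨ (a₁ = b₀ ∧ b₁ = 1 - a₀ - b₀) ∨
        (a₁ = a₀ ∧ b₁ = 1 - a₀ - b₀) ∨ (a₁ = 1 - a₀ - b₀ ∧ b₁ = a₀))) →
    ∀ (r r' : KZ.IntegralRep 1),
      r.domain = {x | x 0 ∈ Set.Ioo (0:ℝ) 1} →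
      Set.EqOn r.integrand (fun x => (x 0) ^ ((a:ℝ) - 1) * (1 - x 0) ^ ((b:ℝ) - 1)) r.domain →
      r'.domain = {x | x 0 ∈ Set.Ioo (0:ℝ) 1} →
      Set.EqOn r'.integrand (fun x => c * (x 0) ^ ((a':ℝ) - 1) * (1 - x 0) ^ ((b':ℝ) - 1)) r'.domain →
      r.value = r'.value → KZ.Equivalent r r' := by
  intro hRefl a b a' b' c ha hb ha' hb' hc hOrbit r r' hd hi hd' hi' hv
  obtain ⟨a₀, b₀, a₁, b₁, i, j, i', j', ha₀, hb₀, hab, hai, hbj, hai', hbj', hcase⟩ := hOrbit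
  -- the triple and its orbit lie in the base window `(0,1]`
  have ha₀1 : a₀ ≤ 1 := by linarith
  have hb₀1 : b₀ ≤ 1 := by linarith
  have ht₀ : 0 < 1 - a₀ - b₀ := by linarith
  obtain ⟨ha₁, ha₁1, hb₁, hb₁1⟩ := orbit_mem_window ha₀ hb₀ hab hcase
  -- reduce the left pair to the window (constant `1` on the left cell)
  refine P_of_class_left (a' := a') (b' := b') a b ha hb (fun a₂ b₂ ha₂ ha₂1 hb₂ hb₂1 hia hjb => ?_)
    1 c r r' isAlgebraic_one hc ⟨hd, fun x hx => by simp only [hi hx, one_mul]⟩ ⟨hd', hi'⟩ hv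
  -- reduce the right pair to the window
  refine P_symm (P_of_class_left (a' := a₂) (b' := b₂) a' b' ha' hb'
    fun a₃ b₃ ha₃ ha₃1 hb₃ hb₃1 hia' hjb' => ?_)
  -- the window representatives are `(a₀, b₀)` and the orbit member `(a₁, b₁)`
  obtain ⟨i₂, hi₂⟩ := hia
  obtain ⟨j₂, hj₂⟩ := hjb
  obtain ⟨i₃, hi₃⟩ := hia'
  obtain ⟨j₃, hj₃⟩ := hjb'
  have h2a : a₂ = a₀ := eq_of_window ha₂ ha₂1 ha₀ ha₀1 ⟨i - i₂, by push_cast; linarith⟩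
  have h2b : b₂ = b₀ := eq_of_window hb₂ hb₂1 hb₀ hb₀1 ⟨j - j₂, by push_cast; linarith⟩
  have h3a : a₃ = a₁ := eq_of_window ha₃ ha₃1 ha₁ ha₁1 ⟨i' - i₃, by push_cast; linarith⟩
  have h3b : b₃ = b₁ := eq_of_window hb₃ hb₃1 hb₁ hb₁1 ⟨j' - j₃, by push_cast; linarith⟩
  rw [h2a, h2b, h3a, h3b]
  -- the two reflections of the triple: `(a₀, b₀) ↔ (t₀, b₀)` and `(b₀, a₀) ↔ (t₀, a₀)`
  have hR₁ := hRefl a₀ b₀ ha₀ hb₀ hab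
  have hR₂ := hRefl b₀ a₀ hb₀ ha₀ (by linarith)
  rw [show (1 - b₀ - a₀ : ℚ) = 1 - a₀ - b₀ by ring] at hR₂
  -- the six members of the orbit
  rcases hcase with ⟨h1, h2⟩ | ⟨h1, h2⟩ | ⟨h1, h2⟩ | ⟨h1, h2⟩ | ⟨h1, h2⟩ | ⟨h1, h2⟩ <;> rw [h1, h2]
  · exact P_diag ha₀ hb₀
  · exact P_swap_left hb₀ ha₀ (P_diag ha₀ hb₀)
  · exact P_symm hR₁
  · exact P_swap_left hb₀ ht₀ (P_symm hR₁)
  · exact P_symm (P_swap_left ha₀ hb₀ (P_symm (P_swap_left ha₀ ht₀ (P_symm hR₂))))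
  · exact P_symm (P_swap_left ha₀ hb₀ hR₂)

end Summit.KontsevichZagierPeriods.FermatIsogeny.BetaLinearSector

end
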